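import Summits.FinalStateConjecture.FinalStateConjecture.Theorems.BartnikGapSettlingGapExhaustionIKStepNormalisedData
import HarnessLib

/-!
# Crux `GapExhaustion` (stmt-FinalStateConjecture-10808), line `photon-shell-pseudoconvexity`:
# stub (N-6cT) `stub_ikQuant6T` — the `T`-CONDITIONAL quantitative pseudo-convexity of the
# normalised data at a cylinder point

Route `BartnikGapSettling`; helper (`--supports stmt-FinalStateConjecture-10808`) of line lead
c12 (wave 1), the `T`-conditional twin of `stub_ikQuant6` (file
`BartnikGapSettlingGapExhaustionIKStepNormalisedData`). Data: a metric datum `G` on an open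
`W ⊆ E4` with `ricAt G = 0`, a point `x ∈ W` on the cylinder `{r = c}`, an exact frame `L` at `x`
(`G x (L·, L·) = η`, `‖L‖, ‖L⁻¹‖ ≤ 6`), a scale `0 < s ≤ 1`, `Ls = s L`, the normalised data
`Gt y = s⁻² G(x + Ls y) ∘ (Ls × Ls)`, `ft y = s⁻² (r(x + Ls y) − c)`, and the stationary
direction in the normalised chart `τ = Ls⁻¹ ∂₀`. From the `T`-conditional multiplier form at
`x` (penalty `ε₁⁻² ((G x ∂₀ w)² + (Dr(x) w)²)`, Ionescu–Klainerman's conditional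
pseudo-convexity, Invent. Math. 2009 Def. 3.1 / Surveys Diff. Geom. 2015 Lemma 2.17, in the
multiplier form of JAMS 2013 Lemma 2.11) we derive, with one constant `A₁`: `‖D ft(0)‖ ≥ A₁⁻¹`,
`A₁⁻¹ ≤ ‖τ‖ ≤ A₁`, and the conditional (quant6) at the origin with penalty
`A₁ ((D ft(0) X)² + (Gt 0 τ X)²)`, using `Gt 0 τ X = s⁻¹ G x ∂₀ (L X)` and the tensoriality of
the coordinate Hessian under the affine change (`affineCov_hessAt`).
-/

noncomputable section

set_option maxSynthPendingDepth 3

-- D-0017: single-problem summit, `Summit.<S>.<S>.…` by design (cf. lakefile `weak.linter.dupNamespace`).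
set_option linter.dupNamespace false

namespace Summit.FinalStateConjecture.FinalStateConjecture.Theorems

open Set Function Metric
open Literature.Geometry.Lorentzian Literature.Geometry.Lorentzian.MetricCoord
open scoped Manifold ContDiff Topology ENNReal

/-! ### Helpers on the scaled frame and the stationary direction -/

/-- `‖L v‖ ≤ ‖L‖ ‖v‖` for a continuous linear equivalence. [folklore] -/
theorem ikStepT_norm_apply_le (L : E4 ≃L[ℝ] E4) (v : E4) :
    ‖L v‖ ≤ ‖(L : E4 →L[ℝ] E4)‖ * ‖v‖ :=
  (L : E4 →L[ℝ] E4).le_opNorm v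

/-- The inverse of the scaled frame: `Ls = s L` gives `Ls⁻¹ v = s⁻¹ L⁻¹ v`. [folklore] -/
theorem ikStepT_symm_apply {s : ℝ} {L Ls : E4 ≃L[ℝ] E4} (hs : s ≠ 0)
    (hLs : ∀ v : E4, Ls v = s • L v) (v : E4) : Ls.symm v = s⁻¹ • L.symm v := by
  rw [ContinuousLinearEquiv.symm_apply_eq, hLs, map_smul, smul_smul, mul_inv_cancel₀ hs, one_smul,
    ContinuousLinearEquiv.apply_symm_apply]

/-- Bounds on the stationary direction in the normalised chart: for `τ = Ls⁻¹ ∂₀` with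
`Ls = s L`, `0 < s ≤ 1`, `‖L‖, ‖L⁻¹‖ ≤ 6`, one has `1 ≤ 6 ‖τ‖` and `‖τ‖ ≤ 6 / s`. [folklore] -/
theorem ikStepT_tau_bounds {s : ℝ} {L Ls : E4 ≃L[ℝ] E4} {τ : E4} (hs : 0 < s) (hs1 : s ≤ 1)
    (hLs : ∀ v : E4, Ls v = s • L v) (hL6 : ‖(L : E4 →L[ℝ] E4)‖ ≤ 6)
    (hLs6 : ‖(L.symm : E4 →L[ℝ] E4)‖ ≤ 6)
    (hτ : τ = (Ls.symm : E4 →L[ℝ] E4) (E4.basisVector 0)) :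
    1 ≤ 6 * ‖τ‖ ∧ ‖τ‖ ≤ 6 / s := by
  have hLsτ : Ls τ = E4.basisVector 0 := by
    rw [hτ, ContinuousLinearEquiv.coe_coe, ContinuousLinearEquiv.apply_symm_apply]
  have hτ' : τ = s⁻¹ • L.symm (E4.basisVector 0) := by
    rw [hτ, ContinuousLinearEquiv.coe_coe, ikStepT_symm_apply hs.ne' hLs]
  -- `‖∂₀‖ = 1` (cf. `BentLabDeviation.norm_basisVector_zero`, not imported here)
  have he0 : ‖(E4.basisVector 0 : E4)‖ = 1 := by simp [E4.basisVector]
  constructor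
  · have h2 : ‖Ls τ‖ ≤ 6 * ‖τ‖ := by
      rw [hLs, norm_smul, Real.norm_eq_abs, abs_of_pos hs]
      calc s * ‖L τ‖ ≤ 1 * (‖(L : E4 →L[ℝ] E4)‖ * ‖τ‖) :=
            mul_le_mul hs1 (ikStepT_norm_apply_le L τ) (norm_nonneg _) zero_le_one
        _ ≤ 1 * (6 * ‖τ‖) := by gcongr
        _ = 6 * ‖τ‖ := one_mul _
    rwa [hLsτ, he0] at h2
  · rw [hτ', norm_smul, Real.norm_eq_abs, abs_of_pos (inv_pos.2 hs)]
    have h1 : ‖L.symm (E4.basisVector 0)‖ ≤ 6 :=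
      calc ‖L.symm (E4.basisVector 0)‖
          ≤ ‖(L.symm : E4 →L[ℝ] E4)‖ * ‖(E4.basisVector 0 : E4)‖ := ikStepT_norm_apply_le L.symm _
        _ ≤ 6 * 1 := by rw [he0]; gcongr
        _ = 6 := by norm_num
    calc s⁻¹ * ‖L.symm (E4.basisVector 0)‖ ≤ s⁻¹ * 6 := by gcongr
      _ = 6 / s := by rw [inv_mul_eq_div]

/-! ### The conditional stub -/

/-- **IK's `T`-conditional quantitative pseudo-convexity (quant6) and non-degeneracy at the
centre** — the registered stub (N-6cT) of line `photon-shell-pseudoconvexity`, crux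
`GapExhaustion` (stmt-FinalStateConjecture-10808), `T`-conditional twin of `stub_ikQuant6`: from
the conditional multiplier form at `x` (penalty `ε₁⁻² ((G x ∂₀ w)² + (Dr(x) w)²)`, the
multiplier form of Ionescu–Klainerman JAMS 2013 Lemma 2.11 for the `T`-conditional
pseudo-convexity of Invent. Math. 2009 Def. 3.1 / Surveys 2015 Lemma 2.17) we get, for the
normalised data `Gt`, `ft` and the stationary direction `τ = Ls⁻¹ ∂₀` of the normalised chart,
`‖D ft(0)‖ ≥ A₁⁻¹`, `A₁⁻¹ ≤ ‖τ‖ ≤ A₁` and (quant6) at the origin with penalty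
`A₁ ((D ft(0) X)² + (Gt 0 τ X)²)`, by the tensoriality of the coordinate Hessian under the
affine change and `Gt 0 τ X = s⁻¹ G x ∂₀ (L X)`. [cite: IonescuKlainerman2013, Lemma 2.11] -/
theorem stub_ikQuant6T : ∀ (G : E4 → E4 →L[ℝ] E4 →L[ℝ] ℝ) (W : Set E4) (a c s : ℝ) (x : E4) (L Ls : E4 ≃L[ℝ] E4) (Gt : E4 → E4 →L[ℝ] E4 →L[ℝ] ℝ) (ft : E4 → ℝ) (τ : E4) (ν ε₁ μ₀ A₁ : ℝ), IsMetricOn G W → (∀ z ∈ W, ricAt G z = 0) → x ∈ W → 0 < s → s ≤ 1 → (∀ v : E4, Ls v = s • L v) → (∀ v w : E4, G x (L v) (L w) = Minkowski.bilin v w) → ‖(L : E4 →L[ℝ] E4)‖ ≤ 6 → ‖(L.symm : E4 →L[ℝ] E4)‖ ≤ 6 → (∀ y : E4, Gt y = (s ^ 2)⁻¹ • (G (x + Ls y)).bilinearComp (Ls : E4 →L[ℝ] E4) (Ls : E4 →L[ℝ] E4)) → Kerr.radius a x = c → (∀ y : E4, ft y = (s ^ 2)⁻¹ * (Kerr.radius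 a (x + Ls y) - c)) → τ = (Ls.symm : E4 →L[ℝ] E4) (E4.basisVector 0) → ContDiffAt ℝ ∞ (Kerr.radius a) x → 0 < ν → 0 < ε₁ → 0 < A₁ → ν ≤ ‖fderiv ℝ (Kerr.radius a) x‖ → |μ₀| ≤ ε₁⁻¹ → (∀ w : E4, ε₁ ^ 2 * ‖w‖ ^ 2 ≤ μ₀ * G x w w - hessAt G (Kerr.radius a) x w w + ε₁⁻¹ ^ 2 * ((G x (E4.basisVector 0) w) ^ 2 + (fderiv ℝ (Kerr.radius a) x w) ^ 2)) → 36 * ε₁⁻¹ ^ 2 ≤ A₁ → ε₁⁻¹ ≤ A₁ → 6 / ν ≤ A₁ → 6 / s ≤ A₁ → A₁⁻¹ ≤ ‖fderiv ℝ ft 0‖ ∧ A₁⁻¹ ≤ ‖τ‖ ∧ ‖τ‖ ≤ A₁ ∧ ∃ μ ∈ Icc (-A₁) A₁, ∀ X : E4, A₁⁻¹ * ‖X‖ ^ 2 ≤ μ * Gt 0 X X - hessAt Gt ft 0 X X + A₁ * ((fderiv ℝ ft 0 X) ^ 2 + (Gt 0 τ X) ^ 2) := by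
  intro G W a c s x L Ls Gt ft τ ν ε₁ μ₀ A₁ hGmet hric hxW hs hs1 hLs hL hL6 hLs6 hGt hx hft hτ hr0 hν
    hε₁ hA₁pos hνx hμ₀ hUin hA₁ε2 hA₁ε hA₁ν hA₁s
  obtain ⟨_, hfd, hfd', _⟩ := ikStep_ft_basic hs hLs hx hft hr0
  obtain ⟨_, _, _, hGthess, hGtap⟩ := ikStep_Gt_basic hGmet hric hs hLs hL hGt
  have haff0 : x + Ls 0 = x := by simp
  have h0W : (0 : E4) ∈ (fun y : E4 => x + Ls y) ⁻¹' W := by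
    show x + Ls 0 ∈ W; rwa [haff0]
  have hLsτ : Ls τ = E4.basisVector 0 := by
    rw [hτ, ContinuousLinearEquiv.coe_coe, ContinuousLinearEquiv.apply_symm_apply]
  -- the non-degeneracy of `D ft(0)`
  have hnorm : A₁⁻¹ ≤ ‖fderiv ℝ ft 0‖ := by
    have hcomp : ‖fderiv ℝ (Kerr.radius a) x‖ ≤
        ‖(fderiv ℝ (Kerr.radius a) x).comp (L : E4 →L[ℝ] E4)‖ * 6 :=
      (ikStep_norm_le_norm_comp_mul _ L).trans (mul_le_mul_of_nonneg_left hLs6 (norm_nonneg _))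
    rw [hfd', norm_smul, Real.norm_eq_abs, abs_of_pos (inv_pos.2 hs)]
    have h1 : A₁⁻¹ ≤ ν / 6 := by
      rw [inv_le_comm₀ hA₁pos (by positivity), inv_div]; exact hA₁ν
    have h2 : ν / 6 ≤ ‖(fderiv ℝ (Kerr.radius a) x).comp (L : E4 →L[ℝ] E4)‖ := by
      rw [div_le_iff₀ (by norm_num)]; exact hνx.trans hcomp
    have h3 : ‖(fderiv ℝ (Kerr.radius a) x).comp (L : E4 →L[ℝ] E4)‖ ≤
        s⁻¹ * ‖(fderiv ℝ (Kerr.radius a) x).comp (L : E4 →L[ℝ] E4)‖ := by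
      have h1s : 1 ≤ s⁻¹ := (one_le_inv₀ hs).2 hs1
      have hn := norm_nonneg ((fderiv ℝ (Kerr.radius a) x).comp (L : E4 →L[ℝ] E4))
      calc ‖(fderiv ℝ (Kerr.radius a) x).comp (L : E4 →L[ℝ] E4)‖
          = 1 * ‖(fderiv ℝ (Kerr.radius a) x).comp (L : E4 →L[ℝ] E4)‖ := (one_mul _).symm
        _ ≤ s⁻¹ * ‖(fderiv ℝ (Kerr.radius a) x).comp (L : E4 →L[ℝ] E4)‖ :=
          mul_le_mul_of_nonneg_right h1s hn
    exact h1.trans (h2.trans h3)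
  -- the bounds on the stationary direction `τ`
  obtain ⟨hτ6, hτs⟩ := ikStepT_tau_bounds hs hs1 hLs hL6 hLs6 hτ
  have h6A : (6 : ℝ) ≤ A₁ := by
    have h6s : (6 : ℝ) ≤ 6 / s := by
      rw [le_div_iff₀ hs]; nlinarith only [hs1, hs]
    exact h6s.trans hA₁s
  have hτlow : A₁⁻¹ ≤ ‖τ‖ := by
    have h3 : A₁⁻¹ ≤ 6⁻¹ := by
      rw [inv_le_comm₀ hA₁pos (by norm_num), inv_inv]; exact h6A
    have h4 : (6 : ℝ)⁻¹ ≤ ‖τ‖ := by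
      rw [inv_le_iff_one_le_mul₀ (by norm_num)]; linarith only [hτ6]
    exact h3.trans h4
  have hτup : ‖τ‖ ≤ A₁ := hτs.trans hA₁s
  refine ⟨hnorm, hτlow, hτup, μ₀, ⟨by linarith [(abs_le.1 hμ₀).1], (abs_le.1 hμ₀).2.trans hA₁ε⟩,
    fun X ↦ ?_⟩
  -- the Hessian of `ft` for `Gt` at `0`, read through `G` at `x`
  have hhess : hessAt Gt ft 0 X X = hessAt G (Kerr.radius a) x (L X) (L X) := by
    rw [hGthess 0 h0W ft, ← affineCov_eq_pullMetric G Ls x, funext hft]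
    have hg2 : ContDiffAt ℝ 2 (fun y : E4 => Kerr.radius a (x + Ls y)) 0 := by
      have haff : ContDiff ℝ 2 (fun y : E4 => x + Ls y) :=
        contDiff_const.add (Ls : E4 →L[ℝ] E4).contDiff
      have hr2 : ContDiffAt ℝ 2 (Kerr.radius a) (x + Ls 0) := by
        rw [haff0]; exact hr0.of_le (WithTop.coe_le_coe.mpr le_top)
      have g1 := ContDiffAt.comp (g := Kerr.radius a) (f := fun y : E4 => x + Ls y) (0 : E4) hr2
        haff.contDiffAt
      simpa only [Function.comp_def] using g1
    rw [ikStep_hessAt_const_mul_sub _ hg2, smul_apply, smul_apply, smul_eq_mul,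
      affineCov_hessAt G (Kerr.radius a) Ls x 0 W hGmet (by rwa [haff0])
        (by rw [haff0]; exact hr0.of_le (WithTop.coe_le_coe.mpr le_top)),
      haff0, hLs]
    simp only [map_smul, smul_apply, smul_eq_mul]
    field_simp
  have hG0 : Gt 0 X X = G x (L X) (L X) := by
    rw [hGtap, haff0, hLs]
    simp only [map_smul, smul_apply, smul_eq_mul]
    field_simp
  have hGτ : Gt 0 τ X = s⁻¹ * G x (E4.basisVector 0) (L X) := by
    rw [hGtap, haff0, hLsτ, hLs, map_smul, smul_eq_mul]
    field_simp
  have hD : fderiv ℝ ft 0 X = s⁻¹ * fderiv ℝ (Kerr.radius a) x (L X) := hfd X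
  rw [hhess, hG0, hD, hGτ]
  -- the inequality
  have hw := hUin (L X)
  have hXn : ‖X‖ ≤ 6 * ‖L X‖ :=
    (ikStep_norm_le_mul_norm_apply L X).trans (mul_le_mul_of_nonneg_right hLs6 (norm_nonneg _))
  have hXn2 : ‖X‖ ^ 2 ≤ 36 * ‖L X‖ ^ 2 := by
    have h := mul_self_le_mul_self (norm_nonneg X) hXn
    nlinarith only [h]
  have hA₁inv : A₁⁻¹ * 36 ≤ ε₁ ^ 2 := by
    rw [inv_mul_le_iff₀ hA₁pos]
    have h1 : 36 * ε₁⁻¹ ^ 2 * ε₁ ^ 2 = 36 := by field_simp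
    have h2 : 36 * ε₁⁻¹ ^ 2 * ε₁ ^ 2 ≤ A₁ * ε₁ ^ 2 :=
      mul_le_mul_of_nonneg_right hA₁ε2 (sq_nonneg _)
    linarith only [h1, h2]
  have hlhs : A₁⁻¹ * ‖X‖ ^ 2 ≤ ε₁ ^ 2 * ‖L X‖ ^ 2 := by
    calc A₁⁻¹ * ‖X‖ ^ 2 ≤ A₁⁻¹ * (36 * ‖L X‖ ^ 2) := by gcongr
      _ = (A₁⁻¹ * 36) * ‖L X‖ ^ 2 := by ring
      _ ≤ ε₁ ^ 2 * ‖L X‖ ^ 2 := by gcongr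
  have hcoef : ε₁⁻¹ ^ 2 ≤ A₁ * s⁻¹ ^ 2 := by
    have h0 : 0 ≤ ε₁⁻¹ ^ 2 := sq_nonneg _
    have h1 : ε₁⁻¹ ^ 2 ≤ A₁ := by linarith only [hA₁ε2, h0]
    have h2 : 1 ≤ s⁻¹ ^ 2 := one_le_pow₀ ((one_le_inv₀ hs).2 hs1)
    calc ε₁⁻¹ ^ 2 ≤ A₁ := h1
      _ = A₁ * 1 := (mul_one _).symm
      _ ≤ A₁ * s⁻¹ ^ 2 := mul_le_mul_of_nonneg_left h2 hA₁pos.le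
  have hrhs : ε₁⁻¹ ^ 2 * (fderiv ℝ (Kerr.radius a) x (L X)) ^ 2 ≤
      A₁ * (s⁻¹ * fderiv ℝ (Kerr.radius a) x (L X)) ^ 2 := by
    rw [mul_pow, ← mul_assoc]
    exact mul_le_mul_of_nonneg_right hcoef (sq_nonneg _)
  have hrhsT : ε₁⁻¹ ^ 2 * (G x (E4.basisVector 0) (L X)) ^ 2 ≤
      A₁ * (s⁻¹ * G x (E4.basisVector 0) (L X)) ^ 2 := by
    rw [mul_pow, ← mul_assoc]
    exact mul_le_mul_of_nonneg_right hcoef (sq_nonneg _)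
  linarith [hw, hlhs, hrhs, hrhsT]

end Summit.FinalStateConjecture.FinalStateConjecture.Theorems

end
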